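import Summits.Ventures.LatticeQCDFlow.Scoring.SU2TorusCharacterIntegral
import Summits.Ventures.LatticeQCDFlow.Scoring.SU2LatticeCharacterExpansion
import Summits.Ventures.LatticeQCDFlow.Scaling.PlaquetteIndependence2D
import Summits.Ventures.LatticeQCDFlow.Scaling.SectorActionFloor
import Literature.Analysis.FunctionSpaces.BesselIRecurrence
import HarnessLib

/-!
# SU(2) on the 2-torus: `Z_{(ℤ/L)²}(β) = Σ_n (c_n(β)/(n+1))^{L²} = Σ_{n ≥ 1} (e^{−2β} I_n(2β)/β)^{L²}`

HONEST FRAMING: exact (Metropolis-corrected) sampling algorithms for lattice gauge theory;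
figures of merit are autocorrelation/cost numbers at stated couplings and volumes; no
continuum-physics claim.

Venture `LatticeQCDFlow` (cell pub-lqcd), sub-topic `Scoring`; FANOUT row 5 (`s0-sun-a`), GEN-10.
NEW WORK of the cell (placement rule); the END of row 5's route to the exact SU(2) torus formula
WITHOUT Peter–Weyl.  GEN-9's `SU2LatticeCharacterExpansion.partitionFunction_su2_toReal_eq_tsum` wrote
theory-2's Wilson partition function `partitionFunction (fundamentalRep (Fin 2)) β` on `(ℤ/L)^d` as the
absolutely convergent character expansion `Σ'_{x : plaquettes → ℕ} (∏_p c_{x_p}(β)) ∫ ∏_p χ_{x_p}(U_p) dHaar^{⊗E}`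
with `c_n(β) = e^{−2β}(I_n(2β) − I_{n+2}(2β))`; `SU2TorusCharacterIntegral` evaluated the Haar integrals
in `d = 2` as `[x ≡ n]·(n+1)^{−L²}`.  Hence (every `L ≥ 1`):

* **`hasSum_partitionFunction_su2_two`** / **`partitionFunction_su2_two_toReal_eq_tsum`** — for `β ≥ 0`,
  `Z_{(ℤ/L)²}^{SU(2)}(β) = Σ_{n ∈ ℕ} (e^{−2β}(I_n(2β) − I_{n+2}(2β))/(n+1))^{L²}`;
* **`partitionFunction_su2_two_toReal_eq_tsum_besselI`** — for `β > 0`, by the Bessel recurrence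
  `2β(I_n − I_{n+2})(2β) = 2(n+1) I_{n+1}(2β)`:
  `Z_{(ℤ/L)²}^{SU(2)}(β) = Σ_{n ∈ ℕ} (e^{−2β} I_{n+1}(2β)/β)^{L²} = (e^{−2β}/β)^{L²} Σ_{n ≥ 1} I_n(2β)^{L²}`
  — the two-dimensional SU(2) lattice Yang–Mills partition function on the torus (Migdal 1975 /
  the `d_r^{2−2g}` heat-kernel–type character formula at genus `1`, here for the Wilson action), as a
  theorem about theory-2's Haar-based lattice measure, all `L ≥ 1`, kernel-checked from the Weyl
  integration formula, the explicit two-angle computations of the convolution and handle identities,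
  and Fubini — no representation theory imported.

Nothing is cited as a fact; no `def` (`Flux.card_site_two` of `Scaling/SectorActionFloor` gives `#Λ = L²`).
-/

noncomputable section

open Real MeasureTheory Set Function Finset Polynomial.Chebyshev
open Literature.MathematicalPhysics.QuantumFieldTheory Literature.MathematicalPhysics.QuantumLattice
open Literature.Analysis.FunctionSpaces
open Summit.Ventures.LatticeQCDFlow.Exactness
open Summit.Ventures.LatticeQCDFlow.Theory2.Lattice

namespace Summit.Ventures.LatticeQCDFlow.Scoring

variable {L : ℕ} [NeZero L]

/-! ## §1. Plaquettes of `(ℤ/L)²` are sites -/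

omit [NeZero L] in
/-- In `d = 2` a plaquette is its base site: `p = (p.1, (0,1))`. -/
theorem plaquette_two_eq (p : Plaquette 2 L) :
    p = (p.1, ⟨((0 : Fin 2), (1 : Fin 2)), by decide⟩) :=
  Prod.ext rfl (TwoDim.plane_eq_zero_one p.2)

/-- `∏_{p} f p = ∏_{x ∈ Λ} f (x, (0,1))` on `(ℤ/L)²`. -/
theorem prod_plaquette_two {M : Type*} [CommMonoid M] (f : Plaquette 2 L → M) :
    ∏ p : Plaquette 2 L, f p = ∏ x : Site 2 L, f (x, ⟨((0 : Fin 2), (1 : Fin 2)), by decide⟩) := by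
  let e : Plaquette 2 L ≃ Site 2 L :=
    { toFun := fun p => p.1
      invFun := fun x => (x, ⟨((0 : Fin 2), (1 : Fin 2)), by decide⟩)
      left_inv := fun p => (plaquette_two_eq p).symm
      right_inv := fun _ => rfl }
  exact Fintype.prod_equiv e _ _ fun p => congrArg f (plaquette_two_eq p)

/-! ## §2. The term of the character expansion at a plaquette assignment -/

/-- **The term of the character expansion**: for `x : plaquettes → ℕ` with base-site assignment
`m = x(·,(0,1))`, `(∏_p c_{x_p}) ∫ ∏_p χ_{x_p}(U_p) dHaar^{⊗E} = [m ≡ m_0]·(c_{m_0}/(m_0+1))^{L²}`. -/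
theorem charExpansion_term_two (β : ℝ) (x : Plaquette 2 L → ℕ) :
    (∏ p, Real.exp (-(2 * β)) * (besselI (x p) (2 * β) - besselI (x p + 2) (2 * β))) *
        ∫ V, ∏ p : Plaquette 2 L, (U ℝ (x p)).eval (su2a0 (plaquetteHolonomy V p.1 p.2.1.1 p.2.1.2))
          ∂(Measure.pi fun _ : Edge 2 L => haarProbability (Matrix.specialUnitaryGroup (Fin 2) ℂ)) =
      if (∀ s : Site 2 L, x (s, ⟨((0 : Fin 2), (1 : Fin 2)), by decide⟩) =
          x ((0 : Site 2 L), ⟨((0 : Fin 2), (1 : Fin 2)), by decide⟩)) then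
        (Real.exp (-(2 * β)) * (besselI (x ((0 : Site 2 L), ⟨((0 : Fin 2), (1 : Fin 2)), by decide⟩)) (2 * β) -
            besselI (x ((0 : Site 2 L), ⟨((0 : Fin 2), (1 : Fin 2)), by decide⟩) + 2) (2 * β)) /
          ((x ((0 : Site 2 L), ⟨((0 : Fin 2), (1 : Fin 2)), by decide⟩) : ℝ) + 1)) ^ (L ^ 2)
      else 0 := by
  set m : Site 2 L → ℕ := fun s => x (s, ⟨((0 : Fin 2), (1 : Fin 2)), by decide⟩) with hm
  have hint : (fun V : GaugeConfig 2 L (Matrix.specialUnitaryGroup (Fin 2) ℂ) =>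
      ∏ p : Plaquette 2 L, (U ℝ (x p)).eval (su2a0 (plaquetteHolonomy V p.1 p.2.1.1 p.2.1.2))) =
      fun V => ∏ s : Site 2 L, (U ℝ (m s)).eval (su2a0 (plaquetteHolonomy V s 0 1)) := by
    funext V
    rw [prod_plaquette_two]
  rw [prod_plaquette_two, hint, integral_prod_su2Character_plaquettes m]
  change (∏ s : Site 2 L, Real.exp (-(2 * β)) * (besselI (m s) (2 * β) - besselI (m s + 2) (2 * β))) *
      (if (∀ s, m s = m 0) then ((((m 0 : ℝ) + 1) ^ (L ^ 2)))⁻¹ else 0) =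
    if (∀ s, m s = m 0) then (Real.exp (-(2 * β)) * (besselI (m 0) (2 * β) - besselI (m 0 + 2) (2 * β)) /
      ((m 0 : ℝ) + 1)) ^ (L ^ 2) else 0
  by_cases hc : ∀ s, m s = m 0
  · rw [if_pos hc, if_pos hc]
    simp_rw [hc]
    rw [Finset.prod_const, Finset.card_univ, Flux.card_site_two, div_pow, div_eq_mul_inv]
  · rw [if_neg hc, if_neg hc, mul_zero]

/-! ## §3. The partition function -/

/-- **`Z_{(ℤ/L)²}^{SU(2)}(β) = Σ_n (c_n(β)/(n+1))^{L²}`** (`β ≥ 0`, `L ≥ 1`), as a `HasSum`: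
the character expansion of theory-2's SU(2) Wilson partition function on the 2-torus collapses to the
diagonal `x ≡ n`, with `c_n(β) = e^{−2β}(I_n(2β) − I_{n+2}(2β))` and `n + 1 = dim`. -/
theorem hasSum_partitionFunction_su2_two {β : ℝ} (hβ : 0 ≤ β) :
    HasSum (fun n : ℕ => (Real.exp (-(2 * β)) * (besselI n (2 * β) - besselI (n + 2) (2 * β)) /
        ((n : ℝ) + 1)) ^ (L ^ 2))
      (partitionFunction (d := 2) (L := L) (fundamentalRep (Fin 2)) β).toReal := by
  obtain ⟨hsum, hZ⟩ := partitionFunction_su2_toReal_eq_tsum 2 L hβ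
  -- the terms of the expansion, as a function of the plaquette assignment
  set T : (Plaquette 2 L → ℕ) → ℝ := fun x =>
    (∏ p, Real.exp (-(2 * β)) * (besselI (x p) (2 * β) - besselI (x p + 2) (2 * β))) *
      ∫ V, ∏ p : Plaquette 2 L, (U ℝ (x p)).eval (su2a0 (plaquetteHolonomy V p.1 p.2.1.1 p.2.1.2))
        ∂(Measure.pi fun _ : Edge 2 L => haarProbability (Matrix.specialUnitaryGroup (Fin 2) ℂ)) with hT
  change Summable T at hsum
  change (partitionFunction (d := 2) (L := L) (fundamentalRep (Fin 2)) β).toReal = ∑' x, T x at hZ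
  -- constant assignments
  set g : ℕ → (Plaquette 2 L → ℕ) := fun n _ => n with hg
  have hginj : Injective g := fun n n' h => by
    have := congrFun h ((0 : Site 2 L), ⟨((0 : Fin 2), (1 : Fin 2)), by decide⟩)
    exact this
  have hsupp : support T ⊆ Set.range g := by
    intro x hx
    rw [mem_support, hT] at hx
    simp only at hx
    rw [charExpansion_term_two β x] at hx
    by_cases hc : ∀ s : Site 2 L, x (s, ⟨((0 : Fin 2), (1 : Fin 2)), by decide⟩) =
        x ((0 : Site 2 L), ⟨((0 : Fin 2), (1 : Fin 2)), by decide⟩)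
    · refine ⟨x ((0 : Site 2 L), ⟨((0 : Fin 2), (1 : Fin 2)), by decide⟩), funext fun p => ?_⟩
      rw [plaquette_two_eq p, hg]
      exact (hc p.1).symm
    · rw [if_neg hc] at hx
      exact (hx rfl).elim
  have hTg : ∀ n : ℕ, T (g n) = (Real.exp (-(2 * β)) * (besselI n (2 * β) - besselI (n + 2) (2 * β)) /
      ((n : ℝ) + 1)) ^ (L ^ 2) := by
    intro n
    rw [hT]
    simp only
    rw [charExpansion_term_two β (g n), if_pos (fun _ => rfl)]
  have hsum' : Summable (T ∘ g) := hsum.comp_injective hginj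
  have heq : ∑' n, T (g n) = ∑' x, T x := hginj.tsum_eq hsupp
  rw [hZ, ← heq]
  simp_rw [← hTg]
  exact hsum'.hasSum

/-- **`Z_{(ℤ/L)²}^{SU(2)}(β) = Σ_n (e^{−2β}(I_n(2β) − I_{n+2}(2β))/(n+1))^{L²}`** (`β ≥ 0`, `L ≥ 1`). -/
theorem partitionFunction_su2_two_toReal_eq_tsum {β : ℝ} (hβ : 0 ≤ β) :
    (partitionFunction (d := 2) (L := L) (fundamentalRep (Fin 2)) β).toReal =
      ∑' n : ℕ, (Real.exp (-(2 * β)) * (besselI n (2 * β) - besselI (n + 2) (2 * β)) /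
        ((n : ℝ) + 1)) ^ (L ^ 2) :=
  (hasSum_partitionFunction_su2_two hβ).tsum_eq.symm

/-- The dimension-normalised character coefficient in Bessel form (`β ≠ 0`):
`c_n(β)/(n+1) = e^{−2β} I_{n+1}(2β)/β` (DLMF 10.29.1). -/
theorem charCoeff_div_succ_eq_besselI (n : ℕ) {β : ℝ} (hβ : β ≠ 0) :
    Real.exp (-(2 * β)) * (besselI n (2 * β) - besselI (n + 2) (2 * β)) / ((n : ℝ) + 1) =
      Real.exp (-(2 * β)) * besselI (n + 1) (2 * β) / β := by
  have h := mul_besselI_sub_besselI_add_two n (2 * β)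
  have hn : ((n : ℝ) + 1) ≠ 0 := by positivity
  have h' : β * (besselI n (2 * β) - besselI (n + 2) (2 * β)) = ((n : ℝ) + 1) * besselI (n + 1) (2 * β) := by
    linarith [h]
  rw [div_eq_div_iff hn hβ]
  linear_combination Real.exp (-(2 * β)) * h'

/-- **THE SU(2) PARTITION FUNCTION OF THE 2-TORUS IN BESSEL FORM**: for `β > 0` and every `L ≥ 1`,
`Z_{(ℤ/L)²}^{SU(2)}(β) = Σ_{n ∈ ℕ} (e^{−2β} I_{n+1}(2β)/β)^{L²}`, i.e.
`Z = (e^{−2β}/β)^{L²} · Σ_{n ≥ 1} I_n(2β)^{L²}` — the two-dimensional lattice Yang–Mills partition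
function of `SU(2)` on the torus for the Wilson action, as a theorem about theory-2's
`partitionFunction (fundamentalRep (Fin 2)) β`. -/
theorem partitionFunction_su2_two_toReal_eq_tsum_besselI {β : ℝ} (hβ : 0 < β) :
    (partitionFunction (d := 2) (L := L) (fundamentalRep (Fin 2)) β).toReal =
      ∑' n : ℕ, (Real.exp (-(2 * β)) * besselI (n + 1) (2 * β) / β) ^ (L ^ 2) := by
  rw [partitionFunction_su2_two_toReal_eq_tsum hβ.le]
  exact tsum_congr fun n => by rw [charCoeff_div_succ_eq_besselI n hβ.ne']

/-- The same with the common factor pulled out: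
`Z_{(ℤ/L)²}^{SU(2)}(β) = (e^{−2β}/β)^{L²} · Σ_{n ∈ ℕ} I_{n+1}(2β)^{L²}` (`β > 0`). -/
theorem partitionFunction_su2_two_toReal_eq_mul_tsum {β : ℝ} (hβ : 0 < β) :
    (partitionFunction (d := 2) (L := L) (fundamentalRep (Fin 2)) β).toReal =
      (Real.exp (-(2 * β)) / β) ^ (L ^ 2) * ∑' n : ℕ, besselI (n + 1) (2 * β) ^ (L ^ 2) := by
  rw [partitionFunction_su2_two_toReal_eq_tsum_besselI hβ, ← tsum_mul_left]
  exact tsum_congr fun n => by rw [← mul_pow]; ring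

/-- Summability of the Bessel form: `Σ_n I_{n+1}(2β)^{L²} < ∞` for `β > 0` (it is `Z·(β e^{2β})^{L²}`). -/
theorem summable_besselI_succ_pow {β : ℝ} (hβ : 0 < β) :
    Summable fun n : ℕ => (Real.exp (-(2 * β)) * besselI (n + 1) (2 * β) / β) ^ (L ^ 2) := by
  have h := (hasSum_partitionFunction_su2_two (L := L) hβ.le).summable
  refine h.congr fun n => ?_
  rw [charCoeff_div_succ_eq_besselI n hβ.ne']

end Summit.Ventures.LatticeQCDFlow.Scoring
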